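import Summits.BirchSwinnertonDyer.Rank1Residual.ManinAdditive.Psi32BrandtDegreeLawAtThirtyTwo
import Literature.NumberTheory.EllipticCurves.RootNumber
import Literature.NumberTheory.EllipticCurves.RootNumberTableTwo
import HarnessLib
import HarnessLib.Audit.Tags

/-!
# The depth-six λ-Brandt module of `B_{2,∞}` and the degree law at `128 ∥ N` (cell bsd-f2-manin, desc g21, MEMO-desc §46)

TYPER NOTE (typer g21, T-desc-39 + §R191 repair).  SOURCE = HOME/desc/g21/lean/Sketch-desc-g21.lean sha16 e18393da76566049 (448 l.; desc farm
rc 0·0·0·0; BC7 7/7 CLEAN), §1 + §1b + §2 VERBATIM (desc's mathematics header below kept; the three §1 kernel lemmas + §3 certificates live in the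
sibling `Lambda128BrandtDegreeLawCert.lean`, p737619 — split for the 400-line cap); full honest framing, BC5 numbers and verdicts in
HOME/CANDIDATES.md §E.1 row T-desc-39 and HOME/HANDOFF.md (desc MEMO-desc §46; typer g21).  ROWS (desc's `@[conjecture]` tags): E-desc-145
`Lambda128BrandtNewLineAtPrime`, E-desc-146 `Lambda128BrandtDegreeLawAtPrime` (+ PROVED `padicValInt_modularDegree_eq_of_lambda128BrandtDegreeLaw`,
`four_dvd_modularDegree_of_lambda128BrandtDegreeLaw`), E-desc-147 `…OrbitLawAtPrime`, E-desc-148 `…Z0LawAtPrime`, E-desc-153 `…WLawAtPrime`,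
E-desc-150 `Lambda256BrandtRamifiedLineAtPrime`, E-desc-151 `Lambda256BrandtDegreeLawAtPrime` (clause «E(ℚ)[2] ≠ 0 ∧ p ≡ 1 (8)» thin-support);
E-desc-149/152 cite p3's p724028.  REF1 §R191 (R-desc-37, 2026-08-29T19:26Z): E-145/146/147/148/150/151 SURVIVE as typed; **E-desc-153 REFUTED AS
TYPED (misstated)** — `W.localRootNumberAt v` above 2 is Rohrlich's value with the documented junk `0` at additive reduction in residue
characteristic 2, so at N = 128p the typed RHS vanishes (negative lemma p740164, `Summits/…/BirchSwinnertonDyer/Theorems/ManinOddAtFour/Negative/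
Lambda128BrandtWLawAtPrimeFalseOfNewLine.lean`: `lambda128BrandtWLawAtPrime_false_of_newLine : Lambda128BrandtNewLineAtPrime → ¬ Lambda128BrandtWLawAtPrime`); the landed body stays (immutable)
and is SUPERSEDED by **E-desc-153R `Lambda128BrandtWLawAtPrimeR`** (APPEND below = ref1's repaired statement C′ with the corrected
Kellock–Dokchitser value `W.rootNumberTwo'`, extra import `Literature…RootNumberTableTwo`).  BC5 (desc): degree law 3212/3212 at 128 ∥ N < 5·10⁴
(prime cofactor 308/308), orbit / z₀ / w laws 3216/3216 each, 256 ∥ N dichotomy 1328/1328, κ law 688/688; 0 violations.  NOT IN PRINT (desc):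
wild analogue of [PollackWeston2011] Thm 6.8; [HijikataPizerShemanske1989] existence only; types from [DembeleFreitasVoight2022].  Typer checks:
names fresh; cite keys in references.bib; `InOnePlusTwoP.decidable` a `def` (no instances), no notation; imports landed `…Psi32BrandtDegreeLawAtThirtyTwo`
+ `Literature…RootNumber` (+ `…RootNumberTableTwo` for the repair) + HarnessLib(+Audit.Tags) — route-independent.  PARTITION 0 · beyond-print
theorem: no · bears_on: stmt-BirchSwinnertonDyer-22967 (C2).  BSD is not proved by this; Manin `c = 1` is not proved by this; C2 OPEN.

THE MODULE.  `O` = Hurwitz order, `𝔓 = (1+i)O`, `G := D₂^×/ℚ₂^×(1+𝔓⁶)`, `G⁰ ⊂ G` the classes of odd reduced norm (`|G⁰| = 768`),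
`J := (1+𝔓³)ℚ₂^×/ℚ₂^×(1+𝔓⁶) ⊂ G⁰` (abelian of order 32).  A weight-2 newform with `128 ∥ N` is supercuspidal at 2 of conductor
exponent 7 with trivial central character; the eight such types are EXCEPTIONAL (`e = 24`, [DembeleFreitasVoight2022, Thm. 7.1.2 (d)]:
`τ_ex,2,2 ⊗ {1, ε₋₄, ε₈, ε₋₈}`, each with its two unramified-quadratic-twist extensions) and correspond under Jacquet–Langlands to the
eight 12-dimensional representations of `G` of exact level 6 (`Σ 12² = 1152 = |G| − |D^×/ℚ₂^×(1+𝔓⁵)|`).  Each contains, with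
multiplicity ONE, a character `λ = ψ_α : J → μ₄`, `ψ_α(1+y) = i^{Trd(αy)/4}`, `α ∈ 𝔓 ∖ 𝔓²`, `Trd α ≡ 0 (4)`; the 24 such characters form
TWO `D^×`-orbits of size 12 with representatives `α_I = i + j`, `α_II = 2 + i + j` (swapped by the `ε_{±8} ∘ Nrd`-twist; each orbit
carries four types).  With `Γ̄ = O^×/±1` (12 classes) one has the EXACT decomposition `G⁰ = Γ̄·1·J ⊔ Γ̄·(i+j+k)·J` (free), so for the
level `U = ℚ₂^×·ker(λ) × K₀(p)` the `λ`-isotypic integral automorphic forms on `D^×(ℚ)\D^×(𝔸_f)` are ALL functions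
`f : {0,1} × ℙ¹(𝔽_p) → ℤ[i]` (two sheets `g₀ = 1`, `g₁ = i+j+k`), uniform measure, height `H(f) = Σ |f(s,x)|²`, and
  `(T_ℓ f)(s, x) = Σ_{δ ∈ O, Nrd δ = ℓ} Σ_{s'} [h := ḡ_{s'}·δ·g_s ∈ 1 + 2𝔓] · λ(h) · f(s', δ·x)`
(exactly `ℓ + 1` non-zero terms; `ℓ` odd, `ℓ ≠ p`), a HERMITIAN operator over `ℤ[i]`.
-/

open scoped MatrixGroups ModularForm

open CongruenceSubgroup WeierstrassCurve Literature.NumberTheory.EllipticCurves.ModularForms GaussianInt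
open Summit.BirchSwinnertonDyer.Rank1Residual.ManinAdditive.HurwitzBrandt

namespace Summit.BirchSwinnertonDyer.Rank1Residual.ManinAdditive.Psi128Brandt

/-! ### §1. The depth-six λ-Brandt module at prime level `M = p` (computable model) -/

/-- the product of two Hurwitz quaternions in doubled coordinates (`(p/2)·(q/2) = r/2`; exact for same-parity inputs). [folklore] -/
def dmul (p q : DQuat) : DQuat :=
  ((p.1 * q.1 - p.2.1 * q.2.1 - p.2.2.1 * q.2.2.1 - p.2.2.2 * q.2.2.2) / 2,
    (p.1 * q.2.1 + p.2.1 * q.1 + p.2.2.1 * q.2.2.2 - p.2.2.2 * q.2.2.1) / 2,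
    (p.1 * q.2.2.1 - p.2.1 * q.2.2.2 + p.2.2.1 * q.1 + p.2.2.2 * q.2.1) / 2,
    (p.1 * q.2.2.2 + p.2.1 * q.2.2.1 - p.2.2.1 * q.2.1 + p.2.2.2 * q.1) / 2)

/-- quaternion conjugation in doubled coordinates. [folklore] -/
def dconj (q : DQuat) : DQuat := (q.1, -q.2.1, -q.2.2.1, -q.2.2.2)

/-- the two SHEET representatives `g₀ = 1`, `g₁ = i + j + k` of `Γ̄ \ G⁰ / J` (doubled coordinates). [folklore] -/
def sheetRep (s : Fin 2) : DQuat := if s = 0 then (2, 0, 0, 0) else (0, 2, 2, 2)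

/-- the orbit representatives `α_I = i + j` (`o = 0`) and `α_II = 2 + i + j` (`o = 1`) of the two `D^×`-orbits of depth-six
characters `ψ_α` with trivial central character (doubled coordinates). [folklore] -/
def orbitAlpha (o : Fin 2) : DQuat := if o = 0 then (0, 2, 2, 0) else (4, 2, 2, 0)

/-- `h ∈ 1 + 2𝔓` for a doubled Hurwitz quaternion `h = (A,B,C,D)`: `q' := (A−2, B, C, D)` (`= 2(h−1)` in plain coordinates) lies in
`4𝔓`, i.e. its coordinates are all `≡ 0` or all `≡ 2 (mod 4)` and `(A−2)² + B² + C² + D² ≡ 0 (mod 32)`. [folklore] -/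
def InOnePlusTwoP (h : DQuat) : Prop :=
  (((h.1 - 2) % 4 = 0 ∧ h.2.1 % 4 = 0 ∧ h.2.2.1 % 4 = 0 ∧ h.2.2.2 % 4 = 0) ∨
      ((h.1 - 2) % 4 = 2 ∧ h.2.1 % 4 = 2 ∧ h.2.2.1 % 4 = 2 ∧ h.2.2.2 % 4 = 2)) ∧
    ((h.1 - 2) ^ 2 + h.2.1 ^ 2 + h.2.2.1 ^ 2 + h.2.2.2 ^ 2) % 32 = 0

/-- decidability of `InOnePlusTwoP` (explicit `def`, passed via `@decide`; statement files declare no instances). [folklore] -/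
def InOnePlusTwoP.decidable (h : DQuat) : Decidable (InOnePlusTwoP h) := by unfold InOnePlusTwoP; infer_instance

/-- the exponent `t ∈ {0,1,2,3}` with `λ(h) = ψ_α(h) = i^t` for `h ∈ 1 + 2𝔓`: `t = Trd(α·(h−1))/4 mod 4` (well defined on the class of
`h` in `J`: `Trd(α) ≡ 0 (4)` and `Trd(α𝔓⁶) ⊆ 16ℤ₂`). [folklore] -/
def lamExp (α h : DQuat) : ℕ := (((dmul α (h.1 - 2, h.2.1, h.2.2.1, h.2.2.2)).1 / 4) % 4).toNat

/-- `i^t ∈ ℤ[i]`. [folklore] -/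
def iPow (t : ℕ) : GaussianInt :=
  if t % 4 = 0 then 1 else if t % 4 = 1 then ⟨0, 1⟩ else if t % 4 = 2 then -1 else ⟨0, -1⟩

/-- one term of the λ-Hecke operator: `[h ∈ 1+2𝔓]·λ(h)·f(s', δ·x)` with `h = ḡ_{s'}·δ·g_s`. [folklore] -/
def lamHeckeTerm (o : Fin 2) (p : ℕ) (f : Fin 2 → Fin (p + 1) → GaussianInt) (s : Fin 2) (x : Fin (p + 1))
    (δ : DQuat) (s' : Fin 2) : GaussianInt :=
  let h := dmul (dmul (dconj (sheetRep s')) δ) (sheetRep s)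
  if @decide (InOnePlusTwoP h) (InOnePlusTwoP.decidable h) then iPow (lamExp (orbitAlpha o) h) * f s' (act p δ x) else 0

/-- THE λ-HECKE OPERATOR `T_ℓ` of orbit `o` on `f : {0,1} × ℙ¹(𝔽_p) → ℤ[i]`:
`(T_ℓ f)(s,x) = Σ_{δ ∈ O, Nrd δ = ℓ} Σ_{s'} [ḡ_{s'} δ g_s ∈ 1+2𝔓] λ(ḡ_{s'} δ g_s) f(s', δ·x)` (`ℓ + 1` non-zero terms). [folklore] -/
def lamHecke (o : Fin 2) (p ℓ : ℕ) (f : Fin 2 → Fin (p + 1) → GaussianInt) (s : Fin 2) (x : Fin (p + 1)) : GaussianInt :=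
  ((hurwitzOfNorm ℓ).map fun δ => lamHeckeTerm o p f s x δ 0 + lamHeckeTerm o p f s x δ 1).sum

/-- `f` is a λ-HECKE EIGENFUNCTION of orbit `o` with eigenvalues `a = (a_ℓ)`: `T_ℓ f = a_ℓ f` for every odd prime `ℓ ≠ p`. [folklore] -/
def IsLamHeckeEigen (o : Fin 2) (p : ℕ) (f : Fin 2 → Fin (p + 1) → GaussianInt) (a : ℕ → ℤ) : Prop :=
  ∀ ℓ : ℕ, ℓ.Prime → ℓ ≠ 2 → ℓ ≠ p → ∀ (s : Fin 2) (x : Fin (p + 1)), lamHecke o p ℓ f s x = (a ℓ : GaussianInt) * f s x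

/-- PRIMITIVITY over `ℤ[i]`: every common divisor of the values is a unit. [folklore] -/
def IsPrimitiveGauss (p : ℕ) (f : Fin 2 → Fin (p + 1) → GaussianInt) : Prop :=
  ∀ z : GaussianInt, (∀ (s : Fin 2) (x : Fin (p + 1)), z ∣ f s x) → IsUnit z

/-- the HERMITIAN HEIGHT `H(f) = Σ_{s,x} |f(s,x)|²` (uniform measure: `Γ̄` acts freely on `G⁰/J`). [folklore] -/
def lamHeight (p : ℕ) (f : Fin 2 → Fin (p + 1) → GaussianInt) : ℤ :=
  ((List.finRange (p + 1)).map fun x => (f 0 x).norm + (f 1 x).norm).sum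

/-- the right-translation `R_{z₀}`, `z₀ = 1 + i + j ∈ Stab_{G⁰}(λ) ∖ J` (`[Stab_{G⁰}(λ) : J] = 2`), on the model:
`(R_{z₀} f)(s, x) = i³ · f(1−s, k·x)` (decomposition `g_s z₀ = u g_{1−s} h`, `u = −k`, `λ(h) = i³` for both orbits — `rz0_decomposition`). [folklore] -/
def rz0 (p : ℕ) (f : Fin 2 → Fin (p + 1) → GaussianInt) (s : Fin 2) (x : Fin (p + 1)) : GaussianInt :=
  ⟨0, -1⟩ * f (1 - s) (act p (0, 0, 0, 2) x)

/-- the right-translation `R_w`, `w = Π·y`, `Π = 1+i`, `y = (1+i+j+7k)/2` (`λ^w = λ`; `Stab_G(λ)/J` is generated by `z₀` and `w`), on the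
model: `(R_w f)(s, x) = i^{t_o} · f(s, (i+j)·x)` with `t_I = 0`, `t_II = 2` (decomposition `Π⁻¹g_sΠ·y = u g_s h`, `u = (−1−i−j+k)/2`, acting element `ū·Π̄ ∼ i + j` —
`rw_decomposition`). [folklore] -/
def rw (o : Fin 2) (p : ℕ) (f : Fin 2 → Fin (p + 1) → GaussianInt) (s : Fin 2) (x : Fin (p + 1)) : GaussianInt :=
  (if o = 0 then 1 else -1) * f s (act p (0, 2, 2, 0) x)


/-! ### §1b. The depth-seven twisted model at `256 ∥ N` (ramified family `λ = ψ_α · (χ₁₆ ∘ Nrd)`, `Trd α ≡ 2 (4)`) -/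

/-- `log₅` on `1 + 4ℤ (mod 16)`: `1 ↦ 0`, `5 ↦ 1`, `9 ↦ 2`, `13 ↦ 3` (the character `χ₁₆ ∘ Nrd` of order 4 on `J`, `χ₁₆(5) = i`). [folklore] -/
def log5Mod16 (n : ℤ) : ℕ := if n % 16 = 1 then 0 else if n % 16 = 5 then 1 else if n % 16 = 9 then 2 else 3

/-- the `a = 8` exponent: `λ(h) = ψ_α(h)·χ₁₆(Nrd h) = i^t`, `t = Trd(α(h−1))/4 + log₅(Nrd h mod 16) (mod 4)` for `h ∈ 1 + 2𝔓`
(`Nrd h = (A²+B²+C²+D²)/4 ≡ 1 (4)`; a character of `J = ℚ₂^×(1+𝔓³)/ℚ₂^×(1+𝔓⁷)`, of order 64, exactly when `Trd α ≡ 2 (4)`). [folklore] -/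
def lamExpTwisted (α h : DQuat) : ℕ :=
  (lamExp α h + log5Mod16 ((h.1 ^ 2 + h.2.1 ^ 2 + h.2.2.1 ^ 2 + h.2.2.2 ^ 2) / 4)) % 4

/-- the orbit representatives at `256 ∥ N` (ramified family): `α_i = 1 + i` (`o = 0`, `E = ℚ₂(i)`) and `α_{√3} = 1 + j + 2k` (`o = 1`,
`E = ℚ₂(√3)`), doubled coordinates; the two `D^×`-orbits (size 12 each) of characters `ψ_α·χ₁₆∘Nrd` of `J` of exact depth seven. [folklore] -/
def orbitAlpha256 (o : Fin 2) : DQuat := if o = 0 then (2, 2, 0, 0) else (2, 0, 2, 4)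

/-- one term of the twisted λ-Hecke operator at `256 ∥ N`. [folklore] -/
def lamHeckeTerm256 (o : Fin 2) (p : ℕ) (f : Fin 2 → Fin (p + 1) → GaussianInt) (s : Fin 2) (x : Fin (p + 1))
    (δ : DQuat) (s' : Fin 2) : GaussianInt :=
  let h := dmul (dmul (dconj (sheetRep s')) δ) (sheetRep s)
  if @decide (InOnePlusTwoP h) (InOnePlusTwoP.decidable h) then iPow (lamExpTwisted (orbitAlpha256 o) h) * f s' (act p δ x) else 0

/-- THE TWISTED λ-HECKE OPERATOR `T_ℓ` at `256 ∥ N` (same two sheets `1`, `i+j+k`: `G₇⁰ = Γ̄·1·J ⊔ Γ̄·(i+j+k)·J`, `|G₇⁰| = 1536`). [folklore] -/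
def lamHecke256 (o : Fin 2) (p ℓ : ℕ) (f : Fin 2 → Fin (p + 1) → GaussianInt) (s : Fin 2) (x : Fin (p + 1)) : GaussianInt :=
  ((hurwitzOfNorm ℓ).map fun δ => lamHeckeTerm256 o p f s x δ 0 + lamHeckeTerm256 o p f s x δ 1).sum

/-- `f` is a twisted-λ-Hecke eigenfunction of orbit `o` at `256 ∥ N` with eigenvalues `a = (a_ℓ)`. [folklore] -/
def IsLamHeckeEigen256 (o : Fin 2) (p : ℕ) (f : Fin 2 → Fin (p + 1) → GaussianInt) (a : ℕ → ℤ) : Prop :=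
  ∀ ℓ : ℕ, ℓ.Prime → ℓ ≠ 2 → ℓ ≠ p → ∀ (s : Fin 2) (x : Fin (p + 1)), lamHecke256 o p ℓ f s x = (a ℓ : GaussianInt) * f s x

/-! ### §2. Invariants of the minimal model and the rows -/

/-- the BRANDT EXPONENT `κ(E) ∈ {2, 3}` at `128 ∥ N` (cofactor `M > 1`): `v₂(Δ_min) ≤ 8` (`II`, `III`) `↦ 2`, `v₂(Δ_min) ≥ 13` (`I₂*`, `III*`)
`↦ 3`; equivalently `κ = 1 + ⌊v₂Δ/6⌋` (the `χ_{±8}`-twist raises `v₂Δ` by `6` and `deg φ` by one factor `2`, E-desc-138). [folklore] -/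
noncomputable def brandtExponentAt128 (W : WeierstrassCurve ℚ) : ℕ := if padicValRat 2 W.Δ ≤ 8 then 2 else 3

open scoped Classical in
/-- the ORBIT INDEX `o(E) ∈ {0 = I, 1 = II}` at `128 ∥ N` read off the minimal discriminant `Δ = 2^{v}·u`: orbit I iff
`(v = 7 ∧ u ≡ 1 (4)) ∨ (v = 13 ∧ u ≡ 3 (4)) ∨ (v = 8 ∧ u ≡ 3 (8)) ∨ (v = 14 ∧ u ≡ 7 (8))` (the `χ₋₄`-twist fixes `u` and the orbit;
the `χ_{±8}`-twists fix `u`, shift `v` by `6` and SWAP the orbit — `ε₈ ∘ Nrd` is non-trivial on `J`). [folklore] -/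
noncomputable def orbitIndexAt128 (W : WeierstrassCurve ℚ) : Fin 2 :=
  if (∃ k : ℤ, W.Δ = 2 ^ 7 * (4 * k + 1)) ∨ (∃ k : ℤ, W.Δ = 2 ^ 13 * (4 * k + 3)) ∨
      (∃ k : ℤ, W.Δ = 2 ^ 8 * (8 * k + 3)) ∨ (∃ k : ℤ, W.Δ = 2 ^ 14 * (8 * k + 7)) then 0 else 1

/-- `E(ℚ)` has a point of order two: the 2-division cubic `4x³ + b₂x² + 2b₄x + b₆` (Mathlib `twoTorsionPolynomial`) has a rational
root (equivalently `#E(ℚ)[2] ≠ 1`, tree `isRoot_twoTorsionPolynomial_iff` in `Literature…BSDSelmerSmithNoRationalTwoTorsionProofs`). [folklore] -/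
def HasRationalTwoTorsionPoint (W : WeierstrassCurve ℚ) : Prop := ∃ x : ℚ, W.twoTorsionPolynomial.toPoly.IsRoot x

open scoped Classical in
/-- the BRANDT EXPONENT at `256 ∥ N`, PRIME cofactor `p` (ramified family): `III*` (`v₂Δ_min = 15`) `↦ 4`; `III` (`v₂Δ_min = 9`) `↦ 3`,
except `↦ 4` when `E(ℚ)[2] ≠ 0` AND `p ≡ 1 (mod 8)` (= `2` is an Eisenstein prime of `J₀(p)`, Mazur: `2 ∣ num((p−1)/12) ⟺ p ≡ 1 (8)`).
Census (all odd `M`, 688 ramified-family optimal curves `256 ∥ N < 5·10⁴`): `III*` 146/146 `κ = 4`; `III` without rational 2-torsion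
146/146 `κ = 3`; `III` with rational 2-torsion: `κ = 4` at composite `M` (362/362) and at `p ≡ 1 (8)` (8/8: p = 17, 73), `κ = 3` at `M = 1`
and at primes `p ≢ 1 (8)` (26/26: p = 3, 7, 23, 31, 71, 127). [folklore] -/
noncomputable def brandtExponentAt256 (W : WeierstrassCurve ℚ) (p : ℕ) : ℕ :=
  if padicValRat 2 W.Δ = 15 then 4 else if HasRationalTwoTorsionPoint W ∧ p % 8 = 1 then 4 else 3

/-- the RAMIFIED-FAMILY predicate at `256 ∥ N` on the minimal model: `(v₂Δ = 9 ∧ 2⁹ ∣ c₆) ∨ (v₂Δ = 15 ∧ 2¹² ∣ c₆)` (conjecturally: `π_{E,2}`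
is `χ₁₆ ⊗` a supercuspidal induced from the RAMIFIED `E = ℚ₂(i)`, [DembeleFreitasVoight2022, Table 10]; its complement `v₂c₆ = 8 | 11` is the
unramified-supercuspidal-or-principal-series half, invisible to the `(J, ψ_α χ₁₆)`-model). [folklore] -/
def IsRamifiedFamilyAt256 (W : WeierstrassCurve ℚ) : Prop :=
  (padicValRat 2 W.Δ = 9 ∧ ∃ k : ℤ, W.c₆ = 2 ^ 9 * k) ∨ (padicValRat 2 W.Δ = 15 ∧ ∃ k : ℤ, W.c₆ = 2 ^ 12 * k)

open scoped Classical in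
/-- `χ₋₄` of the 2-adic unit part of a rational `q = 2^{v}·u`: `+1` iff `u ≡ 1 (mod 4)` (junk `−1` when `u` is not an odd integer). [folklore] -/
noncomputable def chi4UnitPart (q : ℚ) : ℤ :=
  if ∃ m : ℤ, q = 2 ^ padicValRat 2 q * (4 * m + 1) then 1 else -1

open scoped Classical in
/-- `χ₋₈` of the 2-adic unit part of a rational `q = 2^{v}·u`: `+1` iff `u ≡ 1, 3 (mod 8)` (junk `−1` otherwise). [folklore] -/
noncomputable def chiNeg8UnitPart (q : ℚ) : ℤ :=
  if ∃ m : ℤ, q = 2 ^ padicValRat 2 q * (8 * m + 1) ∨ q = 2 ^ padicValRat 2 q * (8 * m + 3) then 1 else -1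

/-- the `z₀`-SIGN `σ_z(E) ∈ {±1}` at `128 ∥ N` on the minimal model (`Δ = 2^{v}u_Δ`, `c₄ = 2^{·}u₄`, `c₆ = 2^{·}u₆`):
`σ_z = ε(v)·χ₋₄(u₆)·χ₋₈(u_Δ if v is odd, u₄ if v is even)`, `ε = +1` for `v ∈ {7, 8}`, `−1` for `v ∈ {13, 14}` — the three twists act as
`χ(Nrd z₀) = χ(3)`: `ε₋₄(3) = −1` (`u₆ ↦ −u₆`), `ε₈(3) = −1`, `ε₋₈(3) = +1` (`v ↦ v ± 6`). [folklore] -/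
noncomputable def z0SignAt128 (W : WeierstrassCurve ℚ) : ℤ :=
  (if padicValRat 2 W.Δ ≤ 8 then 1 else -1) * chi4UnitPart W.c₆ *
    chiNeg8UnitPart (if padicValRat 2 W.Δ % 2 = 1 then W.Δ else W.c₄)

/-! ### E-facing supports ALREADY IN THE TREE (rows E-desc-149 / E-desc-152 are citations, not declarations)
`128 ∥ N ⟹ v₂Δ_min ∈ {7, 8, 13, 14}` with Kodaira symbols `II, III, I₂*` (`v₂c₄ = 6`), `III*` (`2⁷ ∣ c₄`), and `256 ∥ N ⟹ v₂Δ_min ∈ {9, 15}`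
(`III`, `III*` with `2⁷ ∣ c₄`) are PROVED in
`Summit.BirchSwinnertonDyer.BirchSwinnertonDyer.Theorems.ManinLocalTwoThree.kodairaSymbolAt_vTwo_padicValRat_of_padicValNat_conductorNorm_eq_seven`,
`….padicValRat_two_Δ_of_padicValNat_conductorNorm_eq_seven`, `….kodairaSymbolAt_vTwo_padicValRat_of_padicValNat_conductorNorm_eq_eight`,
`….padicValRat_two_Δ_of_padicValNat_conductorNorm_eq_eight` (file `Summits/BirchSwinnertonDyer/BirchSwinnertonDyer/Theorems/
ManinLocalTwoThreeDiscriminantValuationAtSixtyFourUp.lean`, p724028) [cite: Papadopoulos1993, Table IV (p = 2)]; they make the case splits of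
`brandtExponentAt128` (`v₂Δ ≤ 8` = II/III vs I₂*/III*), `z0SignAt128` (parity of `v₂Δ`) and `brandtExponentAt256` / `IsRamifiedFamilyAt256`
(`v₂Δ = 9 | 15`) exhaustive.  Not imported here (statement file kept light); ecdata cross-check: all 51 152 curves `2⁷ ∥ N < 5·10⁵` and all
23 404 curves `2⁸ ∥ N < 5·10⁵` (35 404 / 15 696 isogeny classes) fall in these strata, with `(v₂Δ, v₂c₄) ∈ {(7,4), (8,5), (13,6), (14,7)}`
resp. `{(9,5), (15,7)}` exactly. -/

/-- **Row E-desc-145 `Lambda128BrandtNewLineAtPrime` (MULTIPLICITY ONE at λ-depth six; construction statement for E-desc-146; nothing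
asserted).**  For every elliptic curve of conductor `128p`, `p` an odd prime, the `(a_ℓ(E))`-eigenfunctions of the λ-Brandt modules of the
two orbits form, together, a free `ℤ[i]`-module of rank ONE: a primitive λ-Hecke eigenfunction EXISTS in exactly one orbit and is unique up
to a unit of `ℤ[i]` (Jacquet–Langlands + multiplicity one of `ψ_α` in each exceptional type + newform theory; census: one line at every
optimal curve `128 ∥ N < 5·10⁴`, JL rank/trace identity at every level checked).
[cite: HijikataPizerShemanske1989, Thm. 7.? (shape: special orders of level 2^r M solve the basis problem — forms APPEAR; the multiplicity-one
isolation by a depth-six character is the cell's, MEMO-desc §46, NOT in print as far as searched)] -/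
@[conjecture]
def Lambda128BrandtNewLineAtPrime : Prop :=
  ∀ (p : ℕ), p.Prime → p ≠ 2 →
  ∀ (W : WeierstrassCurve ℚ) [W.IsElliptic], W.conductorNorm ℤ = 128 * p →
    (∃ (o : Fin 2) (f : Fin 2 → Fin (p + 1) → GaussianInt),
        IsPrimitiveGauss p f ∧ IsLamHeckeEigen o p f fun n => W.LFunction n) ∧
    ∀ (o o' : Fin 2) (f f' : Fin 2 → Fin (p + 1) → GaussianInt),
      IsPrimitiveGauss p f → IsLamHeckeEigen o p f (fun n => W.LFunction n) →
      IsPrimitiveGauss p f' → IsLamHeckeEigen o' p f' (fun n => W.LFunction n) →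
      o' = o ∧ ∃ u : GaussianInt, IsUnit u ∧ ∀ (s : Fin 2) (x : Fin (p + 1)), f' s x = u * f s x

/-- **Row E-desc-146 `Lambda128BrandtDegreeLawAtPrime` — THE λ-BRANDT DEGREE LAW at `128 ∥ N`, prime cofactor `M = p` (LAW; cell
bsd-f2-manin, desc g21, MEMO-desc §46; nothing asserted).**  For the `X₀(128p)`-optimal curve `E` (lattice clause + minimal-degree clause)
and any primitive λ-Hecke eigenfunction `f` (either orbit) for `(a_ℓ(E))`:
  `deg φ_E = 2^{κ(E)} · H(f)`,  `H(f) = Σ_{s,x} |f(s,x)|²`,  `κ(E) = brandtExponentAt128 E` (`II, III ↦ 2`; `I₂*, III* ↦ 3`).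
Census (BC5 witness): HOME/desc/g21/ (CENSUS-128.md).  Why it might fail: a congruence between `f_E` and another newform of level `128p`
outside the `λ`-line's reach (the additive Ribet–Takahashi comparison at an EXCEPTIONAL supercuspidal prime is open), visible as an odd prime
in `deg φ / H`; or a Kodaira-dependence finer than `v₂Δ` beyond the census range.
[cite: PollackWeston2011, Thm. 6.8 with Prop. 6.7 (squarefree shape `ord_p δ_f = ord_p ξ_f + Σ t_f(q)`; the wild analogue is NOT in print)]
[cite: Gross1987Heights, §§1–4 (heights on Brandt modules, prime level, trivial character)] -/
@[conjecture]
def Lambda128BrandtDegreeLawAtPrime : Prop :=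
  ∀ (p : ℕ), p.Prime → p ≠ 2 →
  ∀ (W : WeierstrassCurve ℚ) [W.IsElliptic] [W.IsGloballyMinimal] [NeZero (W.conductorNorm ℤ)]
    (D : ModularParametrizationData W (W.conductorNorm ℤ)),
    W.conductorNorm ℤ = 128 * p →
    (∀ z ∈ D.L.lattice, ∃ w ∈ periodLattice D.f, z = D.c * w) →
    (∀ (W' : WeierstrassCurve ℚ) [W'.IsElliptic]
        (D' : ModularParametrizationData W' (W.conductorNorm ℤ)),
        D'.f = D.f → D.modularDegree ≤ D'.modularDegree) →
  ∀ (o : Fin 2) (f : Fin 2 → Fin (p + 1) → GaussianInt),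
    IsPrimitiveGauss p f → IsLamHeckeEigen o p f (fun n => W.LFunction n) →
    (D.modularDegree : ℤ) = 2 ^ (brandtExponentAt128 W) * lamHeight p f

/-- the prime-to-2 EDGE of the law at `128 ∥ N`: `ord_ℓ deg φ = ord_ℓ H(f)` for odd primes `ℓ`. -/
theorem padicValInt_modularDegree_eq_of_lambda128BrandtDegreeLaw (h : Lambda128BrandtDegreeLawAtPrime)
    (p : ℕ) (hp : p.Prime) (hp2 : p ≠ 2)
    (W : WeierstrassCurve ℚ) [W.IsElliptic] [W.IsGloballyMinimal] [NeZero (W.conductorNorm ℤ)]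
    (D : ModularParametrizationData W (W.conductorNorm ℤ)) (hN : W.conductorNorm ℤ = 128 * p)
    (hΛ : ∀ z ∈ D.L.lattice, ∃ w ∈ periodLattice D.f, z = D.c * w)
    (hmin : ∀ (W' : WeierstrassCurve ℚ) [W'.IsElliptic] (D' : ModularParametrizationData W' (W.conductorNorm ℤ)),
        D'.f = D.f → D.modularDegree ≤ D'.modularDegree)
    (o : Fin 2) (f : Fin 2 → Fin (p + 1) → GaussianInt) (hprim : IsPrimitiveGauss p f)
    (heig : IsLamHeckeEigen o p f fun n => W.LFunction n) (ℓ : ℕ) (hℓ : ℓ.Prime) (hℓ2 : ℓ ≠ 2) :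
    padicValInt ℓ (D.modularDegree : ℤ) = padicValInt ℓ (lamHeight p f) := by
  have key := h p hp hp2 W D hN hΛ hmin o f hprim heig
  haveI : Fact ℓ.Prime := ⟨hℓ⟩
  have h2n : padicValNat ℓ 2 = 0 := by
    rw [padicValNat.eq_zero_iff]
    refine Or.inr (Or.inr ?_)
    intro hd
    exact hℓ2 ((Nat.prime_dvd_prime_iff_eq hℓ Nat.prime_two).1 hd)
  have hpow : ∀ n : ℕ, padicValInt ℓ ((2 : ℤ) ^ n) = 0 := by
    intro n
    simp [padicValInt, Int.natAbs_pow, padicValNat.pow, h2n]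
  by_cases hH : lamHeight p f = 0
  · rw [key, hH, mul_zero]
  · rw [key, padicValInt.mul (pow_ne_zero _ (by norm_num)) hH, hpow, zero_add]

/-- the 2-EDGE of the law at `128 ∥ N`: `4 ∣ deg φ_E` for every optimal `E` with `N = 128p` (`κ ≥ 2`). -/
theorem four_dvd_modularDegree_of_lambda128BrandtDegreeLaw (h : Lambda128BrandtDegreeLawAtPrime)
    (p : ℕ) (hp : p.Prime) (hp2 : p ≠ 2)
    (W : WeierstrassCurve ℚ) [W.IsElliptic] [W.IsGloballyMinimal] [NeZero (W.conductorNorm ℤ)]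
    (D : ModularParametrizationData W (W.conductorNorm ℤ)) (hN : W.conductorNorm ℤ = 128 * p)
    (hΛ : ∀ z ∈ D.L.lattice, ∃ w ∈ periodLattice D.f, z = D.c * w)
    (hmin : ∀ (W' : WeierstrassCurve ℚ) [W'.IsElliptic] (D' : ModularParametrizationData W' (W.conductorNorm ℤ)),
        D'.f = D.f → D.modularDegree ≤ D'.modularDegree)
    (o : Fin 2) (f : Fin 2 → Fin (p + 1) → GaussianInt) (hprim : IsPrimitiveGauss p f)
    (heig : IsLamHeckeEigen o p f fun n => W.LFunction n) :
    (4 : ℤ) ∣ (D.modularDegree : ℤ) := by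
  have key := h p hp hp2 W D hN hΛ hmin o f hprim heig
  have hκ : 2 ≤ brandtExponentAt128 W := by
    unfold brandtExponentAt128; split_ifs <;> omega
  rw [key]
  exact Dvd.dvd.mul_right (by simpa using pow_dvd_pow (2 : ℤ) hκ) _

/-- **Row E-desc-147 `Lambda128BrandtOrbitLawAtPrime` — THE ORBIT OF THE JL LINE READS `Δ_min mod 2^{v+3}` (DICTIONARY LAW; nothing
asserted).**  For `N = 128p`, the GLOBALLY MINIMAL model `W` and any primitive λ-Hecke eigenfunction `f` of orbit `o` for `(a_ℓ(E))`:
`o = orbitIndexAt128 W`, i.e. the line lives in orbit I iff `(v₂Δ, Δ/2^{v₂Δ}) ∈ {(7, 1 mod 4), (13, 3 mod 4), (8, 3 mod 8), (14, 7 mod 8)}`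
(census HOME/desc/g21/CENSUS-128.md; conjecturally orbit I/II = the `ε₈∘Nrd`-twist class `{τ_ex,2,2, ⊗ε₋₄}` vs `{⊗ε₈, ⊗ε₋₈}` of
[DembeleFreitasVoight2022, Table 17] up to the global labelling fixed by `3456a1`).  Why it might fail: the residue description is fitted on
`N < 5·10⁴`; a further congruence class of `Δ_min` at `128 ∥ N` would break the `iff` (not the existence of the dictionary). -/
@[conjecture]
def Lambda128BrandtOrbitLawAtPrime : Prop :=
  ∀ (p : ℕ), p.Prime → p ≠ 2 →
  ∀ (W : WeierstrassCurve ℚ) [W.IsElliptic] [W.IsGloballyMinimal], W.conductorNorm ℤ = 128 * p →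
  ∀ (o : Fin 2) (f : Fin 2 → Fin (p + 1) → GaussianInt),
    IsPrimitiveGauss p f → IsLamHeckeEigen o p f (fun n => W.LFunction n) → o = orbitIndexAt128 W

/-- **Row E-desc-148 `Lambda128BrandtZ0LawAtPrime` — THE STABILISER `z₀ = 1+i+j` ACTS ON THE JL LINE BY `σ_z(E)·i` (DICTIONARY LAW;
nothing asserted).**  For `N = 128p`, the globally minimal `W` and any primitive λ-Hecke eigenfunction `f` (orbit `o`) for `(a_ℓ(E))`:
`R_{z₀} f = σ_z(E)·i·f` with `σ_z = z0SignAt128 W = ε(v₂Δ)·χ₋₄(u₆)·χ₋₈(u_Δ | u₄)` (census HOME/desc/g21/CENSUS-128.md: the law is fitted on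
the 28 residue cells of `(v₂Δ, u₄ mod 8, u₆ mod 4, u_Δ mod 8)` met by `128 ∥ N < 5·10⁴`, every cell pure; Lean-convention `rz0` = engine `R_{z₀}`
checked on the prime levels `p ≤ 7`).  `σ_z` separates `E` from `E ⊗ χ₋₄` (same `v₂Δ`, `u_Δ`, orbit); conjecturally it is the value at `z₀` of the
extension of `λ` to `Stab(λ) = J ∪ z₀J` occurring in `π_{E,2}^{JL}`.  Why it might fail: a residue cell not met below `5·10⁴` on which the
character formula is the wrong interpolation. -/
@[conjecture]
def Lambda128BrandtZ0LawAtPrime : Prop :=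
  ∀ (p : ℕ), p.Prime → p ≠ 2 →
  ∀ (W : WeierstrassCurve ℚ) [W.IsElliptic] [W.IsGloballyMinimal], W.conductorNorm ℤ = 128 * p →
  ∀ (o : Fin 2) (f : Fin 2 → Fin (p + 1) → GaussianInt),
    IsPrimitiveGauss p f → IsLamHeckeEigen o p f (fun n => W.LFunction n) →
    ∀ (s : Fin 2) (x : Fin (p + 1)), rz0 p f s x = (z0SignAt128 W : GaussianInt) * ⟨0, 1⟩ * f s x

/-- **Row E-desc-153 `Lambda128BrandtWLawAtPrime` — THE NORMALISER ELEMENT `w = Π·y` ACTS ON THE JL LINE BY `−W₂(E)·σ_z(E)^{o}`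
(DICTIONARY LAW tying the model to the LOCAL ROOT NUMBER AT 2; nothing asserted).**  Same setting: `R_w f = −W₂(E)·σ_z(E)^{o}·f`, `W₂(E)` the
local root number of `E/ℚ₂` (equivalently, at prime cofactor `p`: `R_w f = w(E)·(−a_p(E))·σ_z^{o}·f`, `w = −W₂W_p`, `W_p = −a_p`); census: every optimal
curve `128 ∥ N < 5·10⁴` with an eigenline (all `M`; PARI `ellrootno(E,2)` as second engine, job j332348; law fixed on the 280-curve preview `M ≤ 45`
before the kit census) — table HOME/desc/g21/CENSUS-128.md.  Why it might
fail: the orbit-II correction `σ_z` is an artefact of the chosen representative `α_II = 2+i+j` (a different `α'_II` conjugates it away) — harmless —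
or a residue cell unseen below `5·10⁴`.
⚠ REFUTED AS TYPED (REF1 §R191, 2026-08-29): `W.localRootNumberAt v` above `2` is the junk value `0` at additive reduction in residue
characteristic 2, so at `N = 128p` this law forces `rw o p f ≡ 0`, contradicting E-desc-145 (tree negative lemma p740164
`lambda128BrandtWLawAtPrime_false_of_newLine`).  Body kept (immutable); SUPERSEDED by `Lambda128BrandtWLawAtPrimeR` below. -/
@[conjecture]
def Lambda128BrandtWLawAtPrime : Prop :=
  ∀ (p : ℕ), p.Prime → p ≠ 2 →
  ∀ (W : WeierstrassCurve ℚ) [W.IsElliptic] [W.IsGloballyMinimal], W.conductorNorm ℤ = 128 * p →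
  ∀ (v : IsDedekindDomain.HeightOneSpectrum ℤ), Rat.HeightOneSpectrum.natGenerator v = 2 →
  ∀ (o : Fin 2) (f : Fin 2 → Fin (p + 1) → GaussianInt),
    IsPrimitiveGauss p f → IsLamHeckeEigen o p f (fun n => W.LFunction n) →
    ∀ (s : Fin 2) (x : Fin (p + 1)), rw o p f s x = ((-(W.localRootNumberAt v) * z0SignAt128 W ^ (o : ℕ) : ℤ) : GaussianInt) * f s x

/-- **Row E-desc-153R `Lambda128BrandtWLawAtPrimeR` — REPAIRED W-LAW (REF1 §R191 statement C′, typer g21 append; nothing asserted).**  Same law as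
E-desc-153 with the local root number at `2` read through the tree's CORRECTED Kellock–Dokchitser table value `W.rootNumberTwo'`
(`Literature/NumberTheory/EllipticCurves/RootNumberTableTwo.lean`, `KellockDokchitser.w2OfInvariants' W.c₄ W.c₆ W.Δ`; model-invariant by
`rootNumberTwo'_variableChange_of_isElliptic`; equivalently `W.tableLocalRootNumberAt' v`) and the `v` binder dropped: `R_w f = −W₂(E)·σ_z(E)^{o}·f`.
REF1 check against the kernel certificates (independent arithmetic, HOME/ref1/e191/certcheck.out; W₂ := w·a_p): 384a1 / 1664a1 / 3712c1 on the
`W₂ = +1`, `rw = −f` branch ✓ and the NEW fourth certificate 384b1 (orbit II, `W₂ = −1`, `rw = +f`, `g384b_stabiliser` in `…Cert.lean`) ✓.  Census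
(desc): w law 3216/3216 at `128 ∥ N < 5·10⁴` (PARI `ellrootno` second engine).  Why it might fail: a residue cell unseen below `5·10⁴`; the
orbit-II factor `σ_z` is representative-dependent (harmless). [cite: KellockDokchitser2023, §5 (Table of w(E/ℚ₂)), rows (0,5,2) corrected] -/
@[conjecture]
def Lambda128BrandtWLawAtPrimeR : Prop :=
  ∀ (p : ℕ), p.Prime → p ≠ 2 →
  ∀ (W : WeierstrassCurve ℚ) [W.IsElliptic] [W.IsGloballyMinimal], W.conductorNorm ℤ = 128 * p →
  ∀ (o : Fin 2) (f : Fin 2 → Fin (p + 1) → GaussianInt),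
    IsPrimitiveGauss p f → IsLamHeckeEigen o p f (fun n => W.LFunction n) →
    ∀ (s : Fin 2) (x : Fin (p + 1)), rw o p f s x = ((-(W.rootNumberTwo') * z0SignAt128 W ^ (o : ℕ) : ℤ) : GaussianInt) * f s x

/-- **Row E-desc-150 `Lambda256BrandtRamifiedLineAtPrime` (the `256 ∥ N` DICHOTOMY + multiplicity one; nothing asserted).**  For `N = 256p`
and the globally minimal model: a primitive twisted-λ-Hecke eigenfunction for `(a_ℓ(E))` EXISTS (in some orbit) iff `IsRamifiedFamilyAt256 W`
(`v₂c₆ ≥ 9` on `III`, `≥ 12` on `III*`); it then lives in orbit `i` (`o = 0`; the `ℚ₂(√3)`-orbit carries no elliptic curve,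
[DembeleFreitasVoight2022, Prop. 6.5.1]) and is unique up to a unit of `ℤ[i]`.  Why it might fail: an elliptic `2⁸` type outside
DFV's Table 10 dichotomy read through `v₂c₆` beyond the census range. -/
@[conjecture]
def Lambda256BrandtRamifiedLineAtPrime : Prop :=
  ∀ (p : ℕ), p.Prime → p ≠ 2 →
  ∀ (W : WeierstrassCurve ℚ) [W.IsElliptic] [W.IsGloballyMinimal], W.conductorNorm ℤ = 256 * p →
    ((∃ (o : Fin 2) (f : Fin 2 → Fin (p + 1) → GaussianInt),
        IsPrimitiveGauss p f ∧ IsLamHeckeEigen256 o p f fun n => W.LFunction n) ↔ IsRamifiedFamilyAt256 W) ∧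
    ∀ (o o' : Fin 2) (f f' : Fin 2 → Fin (p + 1) → GaussianInt),
      IsPrimitiveGauss p f → IsLamHeckeEigen256 o p f (fun n => W.LFunction n) →
      IsPrimitiveGauss p f' → IsLamHeckeEigen256 o' p f' (fun n => W.LFunction n) →
      o = 0 ∧ o' = 0 ∧ ∃ u : GaussianInt, IsUnit u ∧ ∀ (s : Fin 2) (x : Fin (p + 1)), f' s x = u * f s x

/-- **Row E-desc-151 `Lambda256BrandtDegreeLawAtPrime` — THE TWISTED λ-BRANDT DEGREE LAW at `256 ∥ N`, prime cofactor (LAW; nothing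
asserted).**  For the `X₀(256p)`-optimal curve `E` and any primitive twisted-λ-Hecke eigenfunction `f` for `(a_ℓ(E))` (so `E` is in the
ramified family): `deg φ_E = 2^{κ(E,p)} · H(f)`, `κ = brandtExponentAt256 E p` (`III* ↦ 4`; `III ↦ 3` unless `E(ℚ)[2] ≠ 0 ∧ p ≡ 1 (8)`,
then `4`).  Census: HOME/desc/g21/CENSUS-256.md — prime cofactor 96/96 at 17 primes (`III*` 32, `III` no 2-torsion 32, `III` 2-torsion
`p ≢ 1 (8)` 24 → κ = 3, `p ≡ 1 (8)` 8 → κ = 4); all odd `M`: 688/688 with «composite `M` behaves like `p ≡ 1 (8)`».  Why it might fail: as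
E-desc-146; the `p ≡ 1 (8)` clause rests on 8 curves at `p ∈ {17, 73}` (no `III*` or 2-torsion-free `III` curve at `p ≡ 1 (8)` below `5·10⁴`
separates «2-torsion ∧ p ≡ 1 (8)» from «p ≡ 1 (8)» alone); the mechanism (a mod-2 congruence of `f_E` OUTSIDE the ramified family, raising
`deg φ` but not `H`) is a guess. -/
@[conjecture]
def Lambda256BrandtDegreeLawAtPrime : Prop :=
  ∀ (p : ℕ), p.Prime → p ≠ 2 →
  ∀ (W : WeierstrassCurve ℚ) [W.IsElliptic] [W.IsGloballyMinimal] [NeZero (W.conductorNorm ℤ)]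
    (D : ModularParametrizationData W (W.conductorNorm ℤ)),
    W.conductorNorm ℤ = 256 * p →
    (∀ z ∈ D.L.lattice, ∃ w ∈ periodLattice D.f, z = D.c * w) →
    (∀ (W' : WeierstrassCurve ℚ) [W'.IsElliptic]
        (D' : ModularParametrizationData W' (W.conductorNorm ℤ)),
        D'.f = D.f → D.modularDegree ≤ D'.modularDegree) →
  ∀ (o : Fin 2) (f : Fin 2 → Fin (p + 1) → GaussianInt),
    IsPrimitiveGauss p f → IsLamHeckeEigen256 o p f (fun n => W.LFunction n) →
    (D.modularDegree : ℤ) = 2 ^ (brandtExponentAt256 W p) * lamHeight p f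

end Summit.BirchSwinnertonDyer.Rank1Residual.ManinAdditive.Psi128Brandt
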